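import Summits.BirchSwinnertonDyer.BirchSwinnertonDyer.Theorems.Rank1ResidualX10bMainConjecture
import Literature.NumberTheory.EllipticCurves.Wuthrich2014.ThreeAdicImageSupersingularProofs
import HarnessLib

/-!
# Class X10a′ ∩ {r = 1} at `p = 3` (surjective mod-`3` image): `BSD(E,3)` from the Schneider certificate
# and `3 ∤ #Ш_an` WITHOUT the binder `hW20` (Wuthrich's Lemma 20 is a tree theorem)

HONEST FRAMING (cell `b2b-bsdres`, run/shared/lean/b2b/bsd-rank1-residual/, verbatim in every
file): the goal of the cell is to DELETE the COMBINATION-SHAPED residual classes of the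
Birch–Swinnerton-Dyer formula for ALL analytic-rank `≤ 1` elliptic curves over `ℚ` — "full BSD
formula for every rank `≤ 1` curve in class `C`" assembled STRICTLY from published theorems — so
that the rank-`≤ 1` remainder becomes exactly the CONSTRUCTION-SHAPED classes, which are TYPED
(missing-input `Prop`s), NOT attempted. This is not "finishing BSD". Team n1011 (N10 / N11), seat
p05, OWNERS row T-b1ss = the `hL20`-BINDER SWEEP: Wuthrich's Lemma 20 (registry A9, the named fact
`Wuthrich2014.lemma20_surjective_threeAdic_of_semistable`: at a prime-to-`9` conductor, `ρ̄_{E,3}`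
onto ⟹ `ρ̄_{E,3ⁿ}` onto for all `n`) is a tree THEOREM since 2026-08-21
(`Wuthrich2014.lemma20_surjective_threeAdic_of_semistable_holds`, file
`Literature/NumberTheory/EllipticCurves/Wuthrich2014/ThreeAdicImageSupersingularProofs.lean`, units
lit-kato / n1011-p02), so every theorem of the cell carrying it as a hypothesis has a twin WITHOUT that
binder.  This file states those twins for the theorems of its sibling (suffix `_noL20`; statement =
the sibling's statement with the binder deleted; proof = the sibling's theorem fed with `_holds`).
No claim beyond the stated classes; labels UNCHANGED; nothing is booked.  Theorems only (no
definition, no named fact minted).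

## What this file proves

The binder-free twin of `X10.bsdp_three_rankOne_surj_of_schneider_of_shaAn_unit`
(`BirchSwinnertonDyer/Theorems/Rank1ResidualX10bMainConjecture.lean`, unit `b2b-bsdres-x10`):
statement = the original with `(hW20 : lemma20_surjective_threeAdic_of_semistable)` deleted.  (The four
rank-`0` theorems of `Rank1ResidualX10MainConjecture.lean` already have binder-free forms in
`X10/MainConjectureBinderFree.lean`, unit x10 gen 13, via the good-ordinary tower
`X10.towerSurj_of_surj`; they are not restated here.)

References: [Wuthrich2014] C. Wuthrich, Doc. Math. 19 (2014), Lemma 20 (p. 399);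
[Kato2004Asterisque] K. Kato, Astérisque 295 (2004), Thm. 17.4 (3); [PerrinRiou1987] §1.4 Cor. 1.8;
[Miller2011LMS] Def. 1.1.
-/

noncomputable section

open scoped Classical MatrixGroups ModularForm

open CongruenceSubgroup WeierstrassCurve Literature.NumberTheory.EllipticCurves
  Literature.NumberTheory.EllipticCurves.ModularForms Literature.NumberTheory.EllipticCurves.Rank1Residual
  Literature.NumberTheory.EllipticCurves.Rank1Residual.Typed
  Literature.NumberTheory.EllipticCurves.Wuthrich2014
  Summit.BirchSwinnertonDyer.BirchSwinnertonDyer.Theorems.Rank1ResidualX1Defs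

set_option autoImplicit false

namespace Summit.BirchSwinnertonDyer.Rank1Residual.X10

variable (W : WeierstrassCurve ℚ) [W.IsElliptic] [W.IsGloballyMinimal]

/-- **Binder-free twin of `X10.bsdp_three_rankOne_surj_of_schneider_of_shaAn_unit`**: the same statement WITHOUT the hypothesis
`Wuthrich2014.lemma20_surjective_threeAdic_of_semistable` (now the tree theorem `…_holds`).
[cite: Kato2004Asterisque, Thm. 17.4 (3) (p. 273)] [cite: PerrinRiou1987, §1.4 Cor. 1.8] [cite: Miller2011LMS, Def. 1.1 (arXiv:1010.2431 p. 3)]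
[cite: Wuthrich2014, Lemma 20 (p. 399)] -/
theorem bsdp_three_rankOne_surj_of_schneider_of_shaAn_unit_noL20
    (hS : Schneider1985_order_charGenerator_odd) (hPR : perrinRiou_rankOne_leadingTerms_odd)
    (hMT : mazur_tate_sigma_exists_odd) (hmod : nonempty_modularParametrizationData)
    (hGZK : rank_eq_analyticRank_of_analyticRank_le_one)
    (hK : ∀ (κ : ZpExtension ℚ 3) (γ : Field.absoluteGaloisGroup ℚ) [NeZero (W.conductorNorm ℤ)]
      (f : CuspForm (Gamma0 (W.conductorNorm ℤ)) 2), kato_divisibility W 3 (κ := κ) (γ := γ) (f := f))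
    (hϖ : ∀ [NeZero (W.conductorNorm ℤ)] (f : CuspForm (Gamma0 (W.conductorNorm ℤ)) 2),
      IsNewformOf W f → ∀ ϖ : ℚ, (ϖ : ℝ) * W.realPeriodRat = plusPeriod f → padicValRat 3 ϖ = 0)
    (hX : ClassX10 W 3) (hsurj : Surj W 3) (hr1 : W.analyticRank = 1)
    (hSch : ∀ Dh : PAdicHeightData W 3, Dh.IsCanonical → SchneiderConjecture Dh)
    (hunit : ∃ q : ℚ, shaAn W = (q : ℂ) ∧ padicValRat 3 q = 0) : BSDp W 3 :=
  Summit.BirchSwinnertonDyer.BirchSwinnertonDyer.Theorems.Rank1ResidualX10bMainConjecture.X10.bsdp_three_rankOne_surj_of_schneider_of_shaAn_unit W hS hPR hMT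
    hmod hGZK Wuthrich2014.lemma20_surjective_threeAdic_of_semistable_holds hK hϖ hX hsurj hr1 hSch hunit

end Summit.BirchSwinnertonDyer.Rank1Residual.X10

end
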